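import Summits.QuantumFields.BalabanUV.Beta.D1BFx.GluonLegProfileD1

/-!
# `BalabanUV.Beta.D1BFx.GluonLegProfileD2` — road «BF-x» for binder row D1, slot (K), END row `hGrp gN`, letter (L1) — THE d2× ROW: THE GLUON LEG's
# MIXED SECOND DIFFERENCE (one step in each site) HAS THE DAMPED `r⁻⁴` PROFILE AT EVERY PAIR («GN-L1-PROFILE-D2»), modulo
# [B5, Prop. 1.2] ∧ [B5, (1.126)–(1.127)] BY NAME

HONEST DEPENDENCY (cell records, verbatim): «continuum YM on T⁴ ⇐ BetaPertH ∧ nine spine estimates (0/9 proved); BetaPertH ⇐ (D1) ∧ (D4) ∧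
CAP+tail; G-an2-4 gates asym, D1 and NE2/3/4.»  HONEST FRAMING (cell contract, verbatim): «discharging `BetaPertH` makes Bałaban's UV stability
UNCONDITIONAL — a real constructive-QFT result; it is NOT the continuum limit and NOT the Clay problem.»  THIS MODULE DISCHARGES NOTHING of the
wall: §1 is the entrywise-limit bookkeeping of `GluonLegProfileD1.Kinf_d1_row_of_prop12` once more, for an5's `VectorTailsPt.legs_pt_A` clause (A 2)
(the d2× row: one difference in the offset, one in the base point — `castT_add_unitVec` moves the base step through the torus dictionary), §2 the
two-case profile packaging in the `Ga`∕`nrm` currency of the HLS kit.  No `def`, no `def … : Prop`, nothing cited, 0 sorry; the printed statements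
enter as HYPOTHESES `h12`∕`h126` by name, never as facts.  Root-level binders hW ∕ hR-sockets ∕ hSX-socket ∕ D1Tel ∕ D1Rep — 0 discharged; (K) NOT
closed; NOT D1, NOT `BetaPertH`, NOT continuum, NOT Clay.

WHY (cell «GN-33∕KK», owner RULING ρ-g10-5 (a); leaf-04-g9's 16-term ledger of the `dip ⊗ dip` word, journal 2026-08-21): after `bubble_dSw_dSw` the
two terms `⟨∇δρ_u, Ga ∇δρ_{u′}⟩·⟨Ga∇p_u, ∇p_{u′}⟩` need `𝔅(δρ,δρ′) ≲ n⁻⁴∕nrm(u−u′)²` (an3-g59 §3′ (4), R2⊗R2, «saturating»); the source dipoles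
`δρ` have the `r⁻³` letter but their gradients have no `r⁻⁴` letter, so BOTH gradients are summed by parts onto the gluon leg, which must then
supply `|Δ^x_μ Δ^y_ν Ga(x,y)| ≤ kG″·e^{−(δ∕n)‖y−x‖}∕nrm(y−x)⁴` — this file.

CONTENT.
* §1 [folklore] **`Kinf_d2_row_of_prop12`** — `∃ δ A₂, ∀ n b w κ l, w ≠ 0 → ∀ μ ν,
  |K^∞((b,κ),(b+(w+e_μ+e_ν),l)) − K^∞((b,κ),(b+(w+e_μ),l)) − (K^∞((b+e_μ,κ),(b+e_μ+(w+e_ν),l)) − K^∞((b+e_μ,κ),(b+e_μ+w,l)))| ≤ A₂e^{−(δ∕n)‖w‖∞}∕‖w‖∞⁴`.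
* §2 [folklore] **`exists_abs_Ga_mixed_diff_le_profile`** — `|Ga n a (x+e_μ) (y+e_ν) κ l − Ga n a (x+e_μ) y κ l − Ga n a x (y+e_ν) κ l + Ga n a x y κ l|
  ≤ kG″·e^{−(δ∕n)‖y−x‖∞}∕nrm(y−x)⁴` at EVERY pair (`kG″ = e^{δ}(16A₂ + 4A_d)`: off `y = x+e_μ` §1 at `b = x`, `w = y−x−e_μ` with the one-step shifts
  `‖y−x‖ ≤ ‖w‖+1`, `nrm(y−x) ≤ 2‖w‖`; at `y = x+e_μ` four flat entries), and the undamped reading `exists_abs_Ga_mixed_diff_le_inv_four`.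
Unit `b2b-balaban-beta-d1-formalise-leaf-04` (gen 9); `LEAVES-BFx.md` row (N) «GN-L1-PROFILE-D2».
-/

noncomputable section

namespace Summit.QuantumFields.BalabanUV.Beta.D1BFx.GluonLegProfileD2

open Filter Topology Finset
open Literature.MathematicalPhysics.QuantumFieldTheory.Balaban1983to89
open Literature.MathematicalPhysics.QuantumFieldTheory.Balaban1983to89.Beta
open B5Prop11Plancherel (calG fine Tor)
open DyadicShell (Pt)
open BubbleTransfer (unitVec)
open VectorTails (castT castT_add)
open VectorTailsPt (rd rdM InBox legs_pt_A eventually_inBox abs_re_le castT_add_unitVec)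
open VectorTailsLoc (fam kfam)
open VectorPropagatorLimit (Kinf calG_re_tendsto_Kinf Kinf_symm)
open BlockKernelVolumeSockets (evenPeriod)
open FreeLegDictionary (cubic)
open PoissonInterior (nrm nrm_pos one_le_nrm nrm_neg supNorm_zero supNorm_neg supNorm_add_le supNorm_single_one)
open Summit.QuantumFields.BalabanUV.Beta.D1BFx.GluonLeg (Ga Ga_apply Ga_symm)
open Summit.QuantumFields.BalabanUV.Beta.D1BFx.LocalTadpoleRows (abs_Ga_le_flatEntry)
open Summit.QuantumFields.BalabanUV.Beta.D1BFx.FrozenLegTails (nOf MOf hn1 sides_tendsto)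
open Summit.QuantumFields.BalabanUV.Beta.D1BFx.PointColumnSplit (cG0)
open Summit.QuantumFields.BalabanUV.Beta.D1BFx.LatticeHLSProfiles (supNorm_dyadic nrm_eq_supNorm_of_ne_zero)
open Summit.QuantumFields.BalabanUV.Beta.D1BFx.LatticeHLSRadial (nrm_eq_max)
open LongitudinalWindow (ellD0)
open WoodburyCovariant (woodburyDc)

variable (a : ℝ) (ha : 0 < a)

/-! ## §1 The d2× tail of every entry of `K^∞` -/

/-- [folklore] **THE d2× ROW OF EVERY ENTRY OF `K^∞`, MODULO [B5, Prop. 1.2] ∧ [B5, (1.126)–(1.127)] BY NAME**: one rate `δ > 0` and one constant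
`A₂ ≥ 0` with `|K^∞((b,κ),(b+(w+e_μ+e_ν),l)) − K^∞((b,κ),(b+(w+e_μ),l)) − (K^∞((b+e_μ,κ),(b+e_μ+(w+e_ν),l)) − K^∞((b+e_μ,κ),(b+e_μ+w,l)))|
≤ A₂e^{−(δ∕n)‖w‖∞}∕‖w‖∞⁴` for every `n ≥ 1`, `b`, `w ≠ 0`, `κ`, `l`, `μ`, `ν` (an5's `legs_pt_A` clause (A 2) for the reading
`n²·Re 𝒢_T((x₀+v,l),(x₀,κ))` on every torus of the family — the base step `x₀ + e_μ` is `castT (b + e_μ)` by `castT_add_unitVec` —, the entrywise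
limit `calG_re_tendsto_Kinf`, and `Kinf_symm`). -/
theorem Kinf_d2_row_of_prop12 (h12 : B5.Prop12Printed (fam nOf hn1 MOf a ha)) (h126 : B5.Kernel126_127Printed (kfam nOf MOf)) :
    ∃ δ A₂ : ℝ, 0 < δ ∧ 0 ≤ A₂ ∧ ∀ (n : ℕ) [NeZero n] (b w : Pt) (κ l : Fin 4), w ≠ 0 → ∀ μ ν : Fin 4,
      |Kinf n a (b, κ) (b + (w + unitVec μ + unitVec ν), l) - Kinf n a (b, κ) (b + (w + unitVec μ), l) -
          (Kinf n a (b + unitVec μ, κ) (b + unitVec μ + (w + unitVec ν), l) - Kinf n a (b + unitVec μ, κ) (b + unitVec μ + w, l))| ≤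
        A₂ * Real.exp (-(δ / n) * DyadicShell.supNorm w) / (DyadicShell.supNorm w : ℝ) ^ 4 := by
  obtain ⟨δ, A, hδ, hA, h⟩ := legs_pt_A nOf hn1 MOf a ha h12 h126
  refine ⟨δ, A 2, hδ, hA 2, fun n _ b w κ l hw μ ν => ?_⟩
  have hn : 1 ≤ n := Nat.one_le_iff_ne_zero.mpr (NeZero.ne n)
  have hbox : ∀ᶠ t : ℕ in atTop, InBox (fine n (cubic 4 (evenPeriod t))) w :=
    eventually_inBox nOf MOf (l := atTop) (fun t : ℕ => ((⟨n, hn⟩ : ℕ+), t)) (sides_tendsto ⟨n, hn⟩) w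
  -- the reading at base point `castT c`, offset `v`
  have erd : ∀ (t : ℕ) (c v : Pt), rd n hn (cubic 4 (evenPeriod t)) a ha (castT _ c) l κ Complex.reAddGroupHom v =
      ((n : ℕ) : ℝ) ^ 2 * (calG n hn (cubic 4 (evenPeriod t)) a ha (castT (fine n (cubic 4 (evenPeriod t))) (c + v), l)
        (castT (fine n (cubic 4 (evenPeriod t))) c, κ)).re := by
    intro t c v
    simp only [rd, rdM, VectorLegVolumeAdapter.re_apply, castT_add]
  have lim : ∀ c v : Pt, Tendsto (fun t : ℕ => rd n hn (cubic 4 (evenPeriod t)) a ha (castT _ c) l κ Complex.reAddGroupHom v) atTop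
      (𝓝 (Kinf n a (c + v, l) (c, κ))) := fun c v => by
    simp only [erd]
    exact calG_re_tendsto_Kinf n hn a ha (by norm_num) (c + v) c l κ
  have key : ∀ t : ℕ, InBox (fine n (cubic 4 (evenPeriod t))) w →
      |rd n hn (cubic 4 (evenPeriod t)) a ha (castT _ b) l κ Complex.reAddGroupHom (w + unitVec μ + unitVec ν) -
            rd n hn (cubic 4 (evenPeriod t)) a ha (castT _ b) l κ Complex.reAddGroupHom (w + unitVec μ) -
          (rd n hn (cubic 4 (evenPeriod t)) a ha (castT _ (b + unitVec μ)) l κ Complex.reAddGroupHom (w + unitVec ν) -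
            rd n hn (cubic 4 (evenPeriod t)) a ha (castT _ (b + unitVec μ)) l κ Complex.reAddGroupHom w)| ≤
        A 2 * Real.exp (-(δ / n) * DyadicShell.supNorm w) / (DyadicShell.supNorm w : ℝ) ^ 4 := fun t ht => by
    have h2 := (h ((⟨n, hn⟩ : ℕ+), t) (castT _ b) l κ Complex.reAddGroupHom abs_re_le w hw ht).2.2.2 μ ν
    rw [← castT_add_unitVec] at h2
    exact h2
  have limF := ((lim b (w + unitVec μ + unitVec ν)).sub (lim b (w + unitVec μ))).sub
    ((lim (b + unitVec μ) (w + unitVec ν)).sub (lim (b + unitVec μ) w))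
  have hsymm : ∀ (x y : Pt), Kinf n a (x, l) (y, κ) = Kinf n a (y, κ) (x, l) := fun x y =>
    Kinf_symm n hn a ha (by norm_num) (x, l) (y, κ)
  rw [← hsymm, ← hsymm, ← hsymm (b + unitVec μ + (w + unitVec ν)), ← hsymm (b + unitVec μ + w)]
  exact le_of_tendsto limF.abs (hbox.mono fun t ht => key t ht)

/-! ## §2 The mixed d2 profile at every pair -/

/-- [folklore] **(L1)-D2× IN PROFILE FORM: `|Ga n a (x+e_μ) (y+e_ν) κ l − Ga n a (x+e_μ) y κ l − Ga n a x (y+e_ν) κ l + Ga n a x y κ l| ≤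
kG″·e^{−(δ∕n)‖y−x‖∞}∕nrm(y−x)⁴` AT EVERY PAIR** (`kG″ = e^{δ}(16A₂ + 4A_d)`): off `y = x + e_μ` §1 at `b = x`, `w = y − x − e_μ ≠ 0` and the one-step
shifts `‖y−x‖∞ ≤ ‖w‖∞ + 1` (so `e^{−(δ∕n)‖w‖} ≤ e^{δ}e^{−(δ∕n)‖y−x‖}`), `nrm(y−x) ≤ 2‖w‖∞`; at `y = x + e_μ` four flat entries (`abs_Ga_le_flatEntry`),
`nrm(e_μ) ≤ 1 + 0 = 1`-currency (`nrm ≥ 1`) and `e^{−(δ∕n)·1} ≥ e^{−δ}`. -/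
theorem exists_abs_Ga_mixed_diff_le_profile (h12 : B5.Prop12Printed (fam nOf hn1 MOf a ha)) (h126 : B5.Kernel126_127Printed (kfam nOf MOf)) :
    ∃ kG'' δ : ℝ, 0 < δ ∧ 0 ≤ kG'' ∧ ∀ (n : ℕ) [NeZero n] (x y : Pt) (κ l μ ν : Fin 4),
      |Ga n a (x + unitVec μ) (y + unitVec ν) κ l - Ga n a (x + unitVec μ) y κ l - Ga n a x (y + unitVec ν) κ l + Ga n a x y κ l| ≤
        kG'' * Real.exp (-(δ / n) * PoissonInterior.supNorm (d := 4) (y - x)) / nrm (d := 4) (y - x) ^ 4 := by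
  obtain ⟨δ, A₂, hδ, hA₂, hrow⟩ := Kinf_d2_row_of_prop12 a ha h12 h126
  set Ad : ℝ := cG0 4 + (woodburyDc 0 + ellD0 4 a) + ellD0 4 a with hAd_def
  have hAd : 0 ≤ Ad := (abs_nonneg _).trans (abs_Ga_le_flatEntry 1 ha 0 0 0 0)
  refine ⟨Real.exp δ * (16 * A₂ + 4 * Ad), δ, hδ, by positivity, fun n _ x y κ l μ ν => ?_⟩
  have hn1 : (1 : ℝ) ≤ n := by exact_mod_cast Nat.one_le_iff_ne_zero.mpr (NeZero.ne n)
  have hn : (0 : ℝ) < n := by linarith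
  have hnrm := nrm_pos (d := 4) (y - x)
  have h1nrm := one_le_nrm (d := 4) (y - x)
  set w : Pt := y - x - unitVec μ with hw_def
  have hsu : PoissonInterior.supNorm (d := 4) (unitVec μ) ≤ 1 := supNorm_single_one μ
  -- `‖y − x‖ ≤ ‖w‖ + 1`
  have htri : PoissonInterior.supNorm (d := 4) (y - x) ≤ PoissonInterior.supNorm (d := 4) w + 1 := by
    have e1 : y - x = w + unitVec μ := by rw [hw_def, sub_add_cancel]
    rw [e1]
    exact (supNorm_add_le _ _).trans (by omega)
  by_cases hw : w = 0
  · -- `y = x + e_μ`: four flat entries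
    have hy : y - x = unitVec μ := by
      have e1 : y - x = w + unitVec μ := by rw [hw_def, sub_add_cancel]
      rw [e1, hw, zero_add]
    have hs1 : (PoissonInterior.supNorm (d := 4) (y - x) : ℝ) ≤ 1 := by rw [hy]; exact_mod_cast hsu
    have hexp : Real.exp (-δ) ≤ Real.exp (-(δ / n) * PoissonInterior.supNorm (d := 4) (y - x)) := by
      rw [Real.exp_le_exp]
      have h1 : δ / n ≤ δ := div_le_self hδ.le hn1
      have h2 : δ / n * PoissonInterior.supNorm (d := 4) (y - x) ≤ δ / n * 1 := mul_le_mul_of_nonneg_left hs1 (by positivity)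
      nlinarith
    have hnrm1 : nrm (d := 4) (y - x) ≤ 1 := by
      rw [nrm_eq_max]; exact max_le le_rfl hs1
    have hn4 : nrm (d := 4) (y - x) ^ 4 ≤ 1 := pow_le_one₀ hnrm.le hnrm1
    have h4 : |Ga n a (x + unitVec μ) (y + unitVec ν) κ l - Ga n a (x + unitVec μ) y κ l - Ga n a x (y + unitVec ν) κ l + Ga n a x y κ l| ≤
        4 * Ad := by
      have t1 := abs_Ga_le_flatEntry n ha (x + unitVec μ) (y + unitVec ν) κ l
      have t2 := abs_Ga_le_flatEntry n ha (x + unitVec μ) y κ l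
      have t3 := abs_Ga_le_flatEntry n ha x (y + unitVec ν) κ l
      have t4 := abs_Ga_le_flatEntry n ha x y κ l
      calc _ ≤ |Ga n a (x + unitVec μ) (y + unitVec ν) κ l - Ga n a (x + unitVec μ) y κ l - Ga n a x (y + unitVec ν) κ l| + |Ga n a x y κ l| :=
            abs_add_le _ _
        _ ≤ |Ga n a (x + unitVec μ) (y + unitVec ν) κ l - Ga n a (x + unitVec μ) y κ l| + |Ga n a x (y + unitVec ν) κ l| + |Ga n a x y κ l| := by
            gcongr; exact abs_sub _ _
        _ ≤ |Ga n a (x + unitVec μ) (y + unitVec ν) κ l| + |Ga n a (x + unitVec μ) y κ l| + |Ga n a x (y + unitVec ν) κ l| + |Ga n a x y κ l| := by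
            gcongr; exact abs_sub _ _
        _ ≤ Ad + Ad + Ad + Ad := by gcongr
        _ = 4 * Ad := by ring
    -- `4Ad ≤ e^{δ}·4Ad·e^{−δ} ≤ kG″·e^{…}∕nrm⁴`
    have hmain : 4 * Ad ≤ Real.exp δ * (16 * A₂ + 4 * Ad) * Real.exp (-(δ / n) * PoissonInterior.supNorm (d := 4) (y - x)) /
        nrm (d := 4) (y - x) ^ 4 := by
      rw [le_div_iff₀ (by positivity)]
      have e1 : Real.exp δ * Real.exp (-δ) = 1 := by rw [← Real.exp_add, add_neg_cancel, Real.exp_zero]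
      calc 4 * Ad * nrm (d := 4) (y - x) ^ 4 ≤ 4 * Ad * 1 := mul_le_mul_of_nonneg_left hn4 (by positivity)
        _ = Real.exp δ * (4 * Ad) * Real.exp (-δ) := by rw [mul_one, mul_comm (Real.exp δ), mul_assoc, e1, mul_one]
        _ ≤ Real.exp δ * (16 * A₂ + 4 * Ad) * Real.exp (-δ) := by gcongr; linarith
        _ ≤ Real.exp δ * (16 * A₂ + 4 * Ad) * Real.exp (-(δ / n) * PoissonInterior.supNorm (d := 4) (y - x)) := by gcongr
    exact h4.trans hmain
  · -- `w ≠ 0`: §1 at `b = x`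
    have h1 := hrow n x w κ l hw μ ν
    have ey1 : x + (w + unitVec μ + unitVec ν) = y + unitVec ν := by rw [hw_def]; abel
    have ey2 : x + (w + unitVec μ) = y := by rw [hw_def]; abel
    have ey3 : x + unitVec μ + (w + unitVec ν) = y + unitVec ν := by rw [hw_def]; abel
    have ey4 : x + unitVec μ + w = y := by rw [hw_def]; abel
    rw [ey1, ey2, ey3, ey4] at h1
    simp only [← Ga_apply] at h1
    -- `h1 : |Ga x (y+e_ν) − Ga x y − (Ga (x+e_μ) (y+e_ν) − Ga (x+e_μ) y)| ≤ A₂ e^{−(δ/n)‖w‖}/‖w‖⁴`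
    have hws : (1 : ℝ) ≤ (DyadicShell.supNorm w : ℝ) := by exact_mod_cast DyadicShell.supNorm_pos hw
    have hwP : (DyadicShell.supNorm w : ℝ) = (PoissonInterior.supNorm (d := 4) w : ℝ) := by rw [supNorm_dyadic]
    have habs : |Ga n a (x + unitVec μ) (y + unitVec ν) κ l - Ga n a (x + unitVec μ) y κ l - Ga n a x (y + unitVec ν) κ l + Ga n a x y κ l| =
        |Ga n a x (y + unitVec ν) κ l - Ga n a x y κ l - (Ga n a (x + unitVec μ) (y + unitVec ν) κ l - Ga n a (x + unitVec μ) y κ l)| := by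
      rw [← abs_neg]; congr 1; ring
    rw [habs]
    refine h1.trans ?_
    -- compare the two profiles
    have htri' : (PoissonInterior.supNorm (d := 4) (y - x) : ℝ) ≤ (DyadicShell.supNorm w : ℝ) + 1 := by rw [hwP]; exact_mod_cast htri
    have hexp : Real.exp (-(δ / n) * DyadicShell.supNorm w) ≤ Real.exp δ * Real.exp (-(δ / n) * PoissonInterior.supNorm (d := 4) (y - x)) := by
      rw [← Real.exp_add, Real.exp_le_exp]
      have h2 : δ / n * PoissonInterior.supNorm (d := 4) (y - x) ≤ δ / n * (DyadicShell.supNorm w + 1) :=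
        mul_le_mul_of_nonneg_left htri' (by positivity)
      have h3 : δ / n ≤ δ := div_le_self hδ.le hn1
      nlinarith [mul_add (δ / n) (DyadicShell.supNorm w : ℝ) 1]
    have hnw : nrm (d := 4) (y - x) ≤ 2 * DyadicShell.supNorm w := by
      rw [nrm_eq_max]
      exact max_le (by linarith) (by linarith)
    have hn4 : nrm (d := 4) (y - x) ^ 4 ≤ 16 * (DyadicShell.supNorm w : ℝ) ^ 4 := by
      calc nrm (d := 4) (y - x) ^ 4 ≤ (2 * (DyadicShell.supNorm w : ℝ)) ^ 4 := pow_le_pow_left₀ hnrm.le hnw 4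
        _ = 16 * (DyadicShell.supNorm w : ℝ) ^ 4 := by ring
    have hsw4 : (0 : ℝ) < (DyadicShell.supNorm w : ℝ) ^ 4 := by positivity
    rw [div_le_div_iff₀ hsw4 (by positivity)]
    calc A₂ * Real.exp (-(δ / n) * DyadicShell.supNorm w) * nrm (d := 4) (y - x) ^ 4
        ≤ A₂ * (Real.exp δ * Real.exp (-(δ / n) * PoissonInterior.supNorm (d := 4) (y - x))) * (16 * (DyadicShell.supNorm w : ℝ) ^ 4) := by
          gcongr
      _ = Real.exp δ * (16 * A₂) * Real.exp (-(δ / n) * PoissonInterior.supNorm (d := 4) (y - x)) * (DyadicShell.supNorm w : ℝ) ^ 4 := by ring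
      _ ≤ Real.exp δ * (16 * A₂ + 4 * Ad) * Real.exp (-(δ / n) * PoissonInterior.supNorm (d := 4) (y - x)) * (DyadicShell.supNorm w : ℝ) ^ 4 := by
          gcongr; linarith

/-- [folklore] **THE UNDAMPED READING** (the kit's `hA` shape, `a = 4`, in `nrm(x−y)`):
`|Ga n a (x+e_μ) (y+e_ν) κ l − Ga n a (x+e_μ) y κ l − Ga n a x (y+e_ν) κ l + Ga n a x y κ l| ≤ kG″∕nrm(x−y)⁴`. -/
theorem exists_abs_Ga_mixed_diff_le_inv_four (h12 : B5.Prop12Printed (fam nOf hn1 MOf a ha)) (h126 : B5.Kernel126_127Printed (kfam nOf MOf)) :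
    ∃ kG'' : ℝ, 0 ≤ kG'' ∧ ∀ (n : ℕ) [NeZero n] (x y : Pt) (κ l μ ν : Fin 4),
      |Ga n a (x + unitVec μ) (y + unitVec ν) κ l - Ga n a (x + unitVec μ) y κ l - Ga n a x (y + unitVec ν) κ l + Ga n a x y κ l| ≤
        kG'' / nrm (d := 4) (x - y) ^ 4 := by
  obtain ⟨kG'', δ, hδ, hk, h⟩ := exists_abs_Ga_mixed_diff_le_profile a ha h12 h126
  refine ⟨kG'', hk, fun n _ x y κ l μ ν => (h n x y κ l μ ν).trans ?_⟩
  have hn : (0 : ℝ) < n := by exact_mod_cast Nat.pos_of_ne_zero (NeZero.ne n)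
  have hnrm := nrm_pos (d := 4) (y - x)
  rw [← nrm_neg (x - y), neg_sub]
  refine div_le_div_of_nonneg_right ?_ (by positivity)
  have hexp : Real.exp (-(δ / n) * PoissonInterior.supNorm (d := 4) (y - x)) ≤ 1 := by
    rw [Real.exp_le_one_iff]
    have : (0 : ℝ) ≤ δ / n * PoissonInterior.supNorm (d := 4) (y - x) := by positivity
    linarith
  calc kG'' * Real.exp (-(δ / n) * PoissonInterior.supNorm (d := 4) (y - x)) ≤ kG'' * 1 := mul_le_mul_of_nonneg_left hexp hk
    _ = kG'' := mul_one _

end Summit.QuantumFields.BalabanUV.Beta.D1BFx.GluonLegProfileD2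

end
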